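import Mathlib.Algebra.Polynomial.Inductions
import Mathlib.LinearAlgebra.DirectSum.Finsupp
import Mathlib.LinearAlgebra.TensorProduct.Quotient
import Mathlib.RingTheory.Algebraic.Integral
import Mathlib.RingTheory.Artinian.Ring
import Mathlib.RingTheory.DedekindDomain.Dvr
import Mathlib.RingTheory.Flat.Localization
import Mathlib.RingTheory.Flat.Stability
import Mathlib.RingTheory.HopkinsLevitzki
import Mathlib.RingTheory.Ideal.AssociatedPrime.Localization
import Mathlib.RingTheory.Ideal.GoingUp
import Mathlib.RingTheory.Ideal.Quotient.Noetherian
import Mathlib.RingTheory.Length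
import Mathlib.RingTheory.Localization.AsSubring
import Mathlib.RingTheory.Localization.Module
import Mathlib.RingTheory.TensorProduct.IsBaseChangeHom
import Literature.RingTheory.DiscreteValuationRing.DeligneSerreLifting

/-!
# The Krull–Akizuki theorem and the Deligne–Serre lifting lemma (Lemme 6.11): proofs

This file discharges the two named facts of
`Literature.RingTheory.DiscreteValuationRing.DeligneSerreLifting`:

* `Literature.KrullAkizuki_holds : KrullAkizuki` — the Krull–Akizuki theorem (Matsumura, *Commutative
  Ring Theory*, Thm. 11.7), Part I;
* `Literature.DeligneSerre1974.lemma611_holds : lemma611` — Deligne–Serre, *Formes modulaires de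
  poids 1*, Ann. Sci. ÉNS 7 (1974), Lemme 6.11 (p. 522), Part II, via
  `Literature.DeligneSerre1974.lemma611_of_krullAkizuki : KrullAkizuki → lemma611`.

Both are pure commutative algebra, whence their home under `Literature/RingTheory` and the
namespaces `Literature.RingTheory.DiscreteValuationRing.KrullAkizuki`, `Literature.DeligneSerre1974` of the statement file; the modular-forms
consequences of Lemme 6.11 (Deligne–Serre 1974, Thm. 6.7 and Thm. 4.1) live in
`Literature.ModularForms.DeligneSerre1974` (`Literature.NumberTheory.EllipticCurves.NewformGaloisRepProofs`).

## Part I: the Krull–Akizuki theorem (Matsumura, Thm. 11.7, pp. 84–86)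

Let `A` be a one-dimensional Noetherian domain with fraction field `K`, `L / K` finite and
`A ⊆ B ⊆ L`. Matsumura's proof (Akizuki's, "in the linear algebra formulation of [B5]"):

* *Lemma* (`KrullAkizuki.length_quot_smul_top_le`): if `M` is a torsion-free `A`-module of finite
  rank `r` — here: an `A`-module embedding in an `r`-dimensional `K`-vector space `V` — then
  `length_A (M ⧸ aM) ≤ r · length_A (A ⧸ aA)` for `0 ≠ a ∈ A`. For `M` finitely generated
  (`KrullAkizuki.length_quot_smul_top_le_of_finite`): a maximal independent subfamily of a
  finite generating family spans a free `E ≅ A^s ⊆ M`, `s ≤ r`, with `C = M ⧸ E` killed by some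
  `t ≠ 0`, hence of finite length (a quotient of `A^m ⧸ tA^m`, and `A ⧸ tA` is Artinian);
  then `n · length (M/aM) = length (M/aⁿM) ≤ length (E/aⁿE) + length C = n·s·length (A/aA) + length C`
  for all `n` (`KrullAkizuki.length_quot_pow_smul_top`,
  `KrullAkizuki.length_quot_smul_top_le_of_finite_coker`), whence the bound. For general `M`,
  every finitely generated submodule of `M ⧸ aM` is a quotient of some `N ⧸ aN` with `N ⊆ M`
  finitely generated, and a module all of whose finitely generated submodules have length `≤ c`
  has length `≤ c` (`KrullAkizuki.length_le_of_forall_fg`).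
* *Theorem* (`KrullAkizuki_holds`): a non-zero ideal `J` of `B` contains a non-zero `a₀ ∈ A`
  (constant term of an algebraic relation of some `0 ≠ b ∈ J`), so
  `length_A (B ⧸ J) ≤ length_A (B ⧸ a₀B) < ∞` by the Lemma with `V = L`; then `J ⧸ a₀B` is a
  finitely generated `B`-module, so `J` is, and `B` is Noetherian; and for a non-zero prime `P`,
  `B ⧸ P` is an Artinian domain, hence a field.

## Part II: the printed proof of Lemme 6.11 (Deligne–Serre 1974, p. 522) and its architecture

Let `𝒪` be a discrete valuation ring (`𝔪`, `k`, `K`), `M` a free `𝒪`-module of finite type,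
`𝒯` a set of pairwise commuting endomorphisms of `M` and `f ∈ M / 𝔪 M = k ⊗ M` a non-zero common
eigenvector, `T f = a_T f`. Deligne–Serre: let `H = 𝒪[𝒯] ⊆ End M`, a commutative `𝒪`-algebra,
free of finite type as a module; `χ : H → k`, `h ↦ (eigenvalue of h on f)`, is a surjective ring
homomorphism with kernel a maximal ideal `𝔫`; choose a minimal prime `𝔭 ⊆ 𝔫`; `𝔭 ∩ 𝒪 = 0`
because `H` is torsion-free, so `D = H / 𝔭` is a one-dimensional domain finite over `𝒪` with
fraction field `K'` finite over `K`; the image `𝔫̄` of `𝔫` is a closed point of `Spec D`, so there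
is a discrete valuation ring `𝒪'` of `K'` dominating `D_{𝔫̄}`; the character
`χ' : H → H/𝔭 ↪ 𝒪'` lifts `χ`, and since `𝔭` is a minimal prime of `H ⊆ End M`, i.e. an
associated prime of the `H`-module `M` (`Supp = Ass` for minimal primes), `χ'` occurs on an
eigenvector of `H` in `K' ⊗ M`, hence (clearing denominators) in `𝒪' ⊗ M`.

Formalisation, bottom-up:

* `exists_eigenvector_of_character` — for a commutative `R`-algebra `H`, finite over `R`, acting
  faithfully on a finite free `R`-module `M`, and a field `L` flat over `R`, every character
  `π : H → L` occurs on a common eigenvector in `L ⊗[R] M` (the kernel of `L ⊗ π` is a maximal,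
  hence minimal, prime of the artinian ring `L ⊗ H`, which acts faithfully on `L ⊗ M` by
  flatness, so it is an associated prime). This is the "`𝔭 ∈ Ass(M)`" step, run after base
  change to `K'` (where it is elementary) rather than over `H` itself.
* `exists_eigenvector_descend` — an eigenvector in `Frac(𝒪') ⊗ M` with eigenvalues in `𝒪'`
  rescales into `𝒪' ⊗ M` (`M` flat).
* `exists_eigenCharacter` — the character `χ : 𝒪[𝒯] → k` of a common eigenvector.
* `exists_dvr_of_isMaximal` — a discrete valuation ring of `K' = Frac D` centred on a closed
  point of a one-dimensional Noetherian domain `D` (localise the integral closure, a Dedekind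
  domain by **Krull–Akizuki** — Mathlib's `IsIntegralClosure.isDedekindDomain` requires
  separability of `K'/K`).
* `exists_lift_of_quotient`, `exists_lift_of_character` — the argument above for an abstract
  commutative `𝒪`-algebra `H` acting faithfully on `M` (stated for an abstract `H` so that no
  instance search ever runs on the subalgebra `𝒪[𝒯] ⊆ End M` with its scoped commutative-ring
  structure), and finally `lemma611_of_krullAkizuki` with `H = 𝒪[𝒯]` and `lemma611_holds`.

## References

* H. Matsumura, *Commutative Ring Theory* (transl. M. Reid), Cambridge Studies in Advanced
  Mathematics 8, Cambridge University Press (1987), Thm. 11.7 (Krull–Akizuki) and its Lemma,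
  pp. 84–86. [cite: Matsumura1987, Thm. 11.7]
* P. Deligne, J.-P. Serre, *Formes modulaires de poids 1*, Ann. Sci. ÉNS (4) 7 (1974), 507–530,
  Lemme 6.11, p. 522. [cite: DeligneSerreASENS1974, Lemme 6.11]
-/

universe u v w

open scoped TensorProduct nonZeroDivisors Pointwise
open Module

/-! ## Part I. The Krull–Akizuki theorem -/

namespace Literature.RingTheory.DiscreteValuationRing

namespace KrullAkizuki



section Regular

variable {R : Type*} [CommRing R] {X : Type*} [AddCommGroup X] [Module R X]

/-- Membership in the pointwise scalar multiple `a • ⊤` of a module. [folklore] -/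
lemma mem_smul_top_iff (a : R) (x : X) : x ∈ (a • ⊤ : Submodule R X) ↔ ∃ y : X, a • y = x := by
  simp [Submodule.mem_smul_pointwise_iff_exists]

/-- `a ^ (n + 1) • X ≤ a ^ n • X`. [folklore] -/
lemma pow_succ_smul_top_le (a : R) (n : ℕ) :
    (a ^ (n + 1) • ⊤ : Submodule R X) ≤ a ^ n • ⊤ := by
  intro x hx
  obtain ⟨y, rfl⟩ := (mem_smul_top_iff _ x).mp hx
  exact (mem_smul_top_iff _ _).mpr ⟨a • y, by rw [smul_smul, ← pow_succ]⟩

/-- The map `X ⧸ aX → X ⧸ a^{n+1} X` induced by multiplication by `a ^ n`. [folklore] -/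
noncomputable def powQuotMap (a : R) (n : ℕ) :
    (X ⧸ (a • ⊤ : Submodule R X)) →ₗ[R] X ⧸ (a ^ (n + 1) • ⊤ : Submodule R X) :=
  Submodule.mapQ _ _ (a ^ n • LinearMap.id) fun x hx ↦ by
    obtain ⟨y, rfl⟩ := (mem_smul_top_iff a x).mp hx
    exact (mem_smul_top_iff _ _).mpr
      ⟨y, by rw [LinearMap.smul_apply, LinearMap.id_apply, smul_smul, ← pow_succ]⟩

/-- `powQuotMap` on representatives. [folklore] -/
lemma powQuotMap_mk (a : R) (n : ℕ) (x : X) :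
    powQuotMap a n (Submodule.Quotient.mk x) = Submodule.Quotient.mk (a ^ n • x) := rfl

/-- `length (X ⧸ a^n X) = n • length (X ⧸ a X)` when `a` is `X`-regular. [folklore] -/
theorem length_quot_pow_smul_top {a : R} (ha : IsSMulRegular X a) (n : ℕ) :
    Module.length R (X ⧸ (a ^ n • ⊤ : Submodule R X)) =
      n * Module.length R (X ⧸ (a • ⊤ : Submodule R X)) := by
  induction n with
  | zero =>
    haveI : Subsingleton (X ⧸ (a ^ 0 • ⊤ : Submodule R X)) :=
      Submodule.Quotient.subsingleton_iff.mpr (by rw [pow_zero, one_smul])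
    rw [Nat.cast_zero, zero_mul, Module.length_eq_zero]
  | succ n ih =>
    -- exact sequence `0 → X/aX → X/a^{n+1}X → X/a^nX → 0`
    have hpow := pow_succ_smul_top_le (X := X) a n
    have hinj : Function.Injective (powQuotMap (X := X) a n) := by
      rw [← LinearMap.ker_eq_bot, eq_bot_iff]
      intro x hx
      induction x using Submodule.Quotient.induction_on with
      | H x =>
        rw [LinearMap.mem_ker, powQuotMap_mk, Submodule.Quotient.mk_eq_zero, mem_smul_top_iff] at hx
        obtain ⟨y, hy⟩ := hx
        rw [Submodule.mem_bot, Submodule.Quotient.mk_eq_zero, mem_smul_top_iff]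
        refine ⟨y, ha.pow n ?_⟩
        dsimp only
        rw [smul_smul, ← pow_succ, hy]
    have hsurj : Function.Surjective (Submodule.factor hpow) := Submodule.factor_surjective hpow
    have hexact : Function.Exact (powQuotMap (X := X) a n) (Submodule.factor hpow) := by
      rw [LinearMap.exact_iff]
      refine le_antisymm ?_ ?_
      · intro y hy
        induction y using Submodule.Quotient.induction_on with
        | H y =>
          rw [LinearMap.mem_ker, ← Submodule.mkQ_apply, Submodule.factor_mk, Submodule.mkQ_apply,
            Submodule.Quotient.mk_eq_zero, mem_smul_top_iff] at hy
          obtain ⟨z, rfl⟩ := hy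
          exact ⟨Submodule.Quotient.mk z, powQuotMap_mk a n z⟩
      · rintro _ ⟨x, rfl⟩
        induction x using Submodule.Quotient.induction_on with
        | H x =>
          rw [LinearMap.mem_ker, powQuotMap_mk, ← Submodule.mkQ_apply, Submodule.factor_mk,
            Submodule.mkQ_apply, Submodule.Quotient.mk_eq_zero, mem_smul_top_iff]
          exact ⟨x, rfl⟩
    rw [Module.length_eq_add_of_exact _ _ hinj hsurj hexact, ih, Nat.cast_succ, add_mul, one_mul,
      add_comm]

/-- **Akizuki's inequality.** If `a` is `M`-regular, `E → M` is a linear map and the cokernel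
`C` of `E → M` has finite length, then `length (M ⧸ aM) ≤ length (E ⧸ aE)`: for every `n`,
`n • length (M/aM) = length (M/aⁿM) ≤ length (E/aⁿE) + length C ≤ n • length (E/aE) + length C`.
[folklore] -/
theorem length_quot_smul_top_le_of_finite_coker {E : Type*} [AddCommGroup E] [Module R E]
    (f : E →ₗ[R] X) {a : R} (ha : IsSMulRegular X a) (haE : IsSMulRegular E a)
    (hC : Module.length R (X ⧸ LinearMap.range f) ≠ ⊤) :
    Module.length R (X ⧸ (a • ⊤ : Submodule R X)) ≤
      Module.length R (E ⧸ (a • ⊤ : Submodule R E)) := by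
  -- Step 1: `length (X/aⁿX) ≤ length (E/aⁿE) + length C` for all `n`.
  have key : ∀ n : ℕ, Module.length R (X ⧸ (a ^ n • ⊤ : Submodule R X)) ≤
      Module.length R (E ⧸ (a ^ n • ⊤ : Submodule R E)) +
        Module.length R (X ⧸ LinearMap.range f) := by
    intro n
    -- the map `E/aⁿE → X/aⁿX`
    let φ : (E ⧸ (a ^ n • ⊤ : Submodule R E)) →ₗ[R] X ⧸ (a ^ n • ⊤ : Submodule R X) :=
      Submodule.mapQ _ _ f fun e he ↦ by
        obtain ⟨e', rfl⟩ := (mem_smul_top_iff _ e).mp he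
        exact (mem_smul_top_iff _ _).mpr ⟨f e', by rw [map_smul]⟩
    -- `length (X/aⁿX) = length (range φ) + length ((X/aⁿX) ⧸ range φ)`
    have h1 := Module.length_eq_add_of_exact (LinearMap.range φ).subtype (LinearMap.range φ).mkQ
      (Submodule.subtype_injective _) (Submodule.mkQ_surjective _)
      (LinearMap.exact_subtype_mkQ (LinearMap.range φ))
    have h2 : Module.length R (LinearMap.range φ) ≤
        Module.length R (E ⧸ (a ^ n • ⊤ : Submodule R E)) :=
      Module.length_le_of_surjective φ.rangeRestrict φ.surjective_rangeRestrict
    -- `(X/aⁿX) ⧸ range φ` is a quotient of `X ⧸ range f`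
    let ψ : (X ⧸ LinearMap.range f) →ₗ[R] (X ⧸ (a ^ n • ⊤ : Submodule R X)) ⧸ LinearMap.range φ :=
      Submodule.liftQ _ ((LinearMap.range φ).mkQ ∘ₗ (a ^ n • ⊤ : Submodule R X).mkQ) (by
        rintro _ ⟨e, rfl⟩
        rw [LinearMap.mem_ker, LinearMap.comp_apply, Submodule.mkQ_apply, Submodule.mkQ_apply,
          Submodule.Quotient.mk_eq_zero]
        exact ⟨Submodule.Quotient.mk e, rfl⟩)
    have hψ : Function.Surjective ψ := by
      intro z
      obtain ⟨y, rfl⟩ := Submodule.mkQ_surjective _ z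
      obtain ⟨x, rfl⟩ := Submodule.mkQ_surjective _ y
      exact ⟨Submodule.Quotient.mk x, rfl⟩
    have h3 := Module.length_le_of_surjective ψ hψ
    rw [h1]
    exact add_le_add h2 h3
  -- Step 2: rewrite with `length (X/aⁿX) = n • length (X/aX)` and let `n → ∞`.
  simp_rw [length_quot_pow_smul_top ha, length_quot_pow_smul_top haE] at key
  generalize Module.length R (X ⧸ (a • ⊤ : Submodule R X)) = x at key
  generalize Module.length R (E ⧸ (a • ⊤ : Submodule R E)) = y at key
  generalize Module.length R (X ⧸ LinearMap.range f) = c at key hC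
  -- arithmetic in `ℕ∞`
  induction y using ENat.recTopCoe with
  | top => exact le_top
  | coe y =>
    lift c to ℕ using hC
    induction x using ENat.recTopCoe with
    | top =>
      exfalso
      have := key 1
      simp only [Nat.cast_one, one_mul] at this
      exact ENat.coe_ne_top _ (top_le_iff.mp (by exact_mod_cast this))
    | coe x =>
      have := key (c + 1)
      have h' : ((c + 1 : ℕ) : ℕ∞) * (x : ℕ∞) ≤ ((c + 1 : ℕ) : ℕ∞) * y + c := by exact_mod_cast this
      norm_cast at h'
      exact_mod_cast (show x ≤ y by nlinarith [h'])

end Regular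



/-! ### Lengths of `F ⧸ aF` for `F` free, and of `A ⧸ aA` -/

section Free

variable {A : Type*} [CommRing A]

/-- For a finite free `A`-module `F` of rank `s`, `length (F ⧸ aF) = s • length (A ⧸ aA)`
(`F ⧸ aF ≃ (A ⧸ aA) ⊗ F ≃ (A ⧸ aA)^s`). [folklore] -/
theorem length_quot_smul_top_of_free {F : Type*} [AddCommGroup F] [Module A F]
    {ι : Type*} [Finite ι] (b : Basis ι A F) (a : A) :
    Module.length A (F ⧸ (a • ⊤ : Submodule A F)) =
      Nat.card ι * Module.length A (A ⧸ Ideal.span {a}) := by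
  classical
  let I : Ideal A := Ideal.span {a}
  have e1 : ((A ⧸ I) ⊗[A] F) ≃ₗ[A] F ⧸ (a • ⊤ : Submodule A F) :=
    TensorProduct.quotTensorEquivQuotSMul F I ≪≫ₗ
      Submodule.quotEquivOfEq _ _ (Submodule.ideal_span_singleton_smul a ⊤)
  have e2 : ((A ⧸ I) ⊗[A] F) ≃ₗ[A] (ι →₀ A ⧸ I) :=
    TensorProduct.congr (LinearEquiv.refl A (A ⧸ I)) b.repr ≪≫ₗ
      TensorProduct.finsuppScalarRight A A (A ⧸ I) ι
  rw [← e1.length_eq, e2.length_eq, Module.length_finsupp, ENat.card_eq_coe_natCard]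

end Free

section DimOne

variable {A : Type*} [CommRing A] [IsNoetherianRing A] [Ring.DimensionLEOne A]

/-- In a one-dimensional Noetherian ring, `A ⧸ aA` is an Artinian ring for `a ≠ 0` (every prime
containing `a` is maximal). [folklore] -/
theorem isArtinianRing_quot_span_singleton {a : A} (ha : a ≠ 0) :
    IsArtinianRing (A ⧸ Ideal.span {a}) := by
  have : Ring.KrullDimLE 0 (A ⧸ Ideal.span {a}) := Ring.krullDimLE_zero_iff.mpr fun J hJ ↦ by
    have h1 : (J.comap (Ideal.Quotient.mk (Ideal.span {a}))).IsPrime := hJ.comap _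
    have h2 : J.comap (Ideal.Quotient.mk (Ideal.span {a})) ≠ ⊥ := fun h ↦ ha <| by
      have : a ∈ J.comap (Ideal.Quotient.mk (Ideal.span {a})) := by
        rw [Ideal.mem_comap, Ideal.Quotient.eq_zero_iff_mem.mpr (Ideal.mem_span_singleton_self a)]
        exact J.zero_mem
      rwa [h, Ideal.mem_bot] at this
    have h3 := Ring.DimensionLEOne.maximalOfPrime h2 h1
    have h4 := Ideal.map_eq_top_or_isMaximal_of_surjective (Ideal.Quotient.mk (Ideal.span {a}))
      Ideal.Quotient.mk_surjective h3
    rw [Ideal.map_comap_of_surjective (Ideal.Quotient.mk (Ideal.span {a}))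
      Ideal.Quotient.mk_surjective] at h4
    exact h4.resolve_left hJ.ne_top
  exact IsNoetherianRing.isArtinianRing_of_krullDimLE_zero

/-- In a one-dimensional Noetherian ring, `A ⧸ aA` has finite length for `a ≠ 0`. [folklore] -/
theorem length_quot_span_singleton_ne_top {a : A} (ha : a ≠ 0) :
    Module.length A (A ⧸ Ideal.span {a}) ≠ ⊤ := by
  haveI := isArtinianRing_quot_span_singleton ha
  rw [Module.length_eq_of_surjective (S := A) (R := A ⧸ Ideal.span {a}) Ideal.Quotient.mk_surjective]
  exact Module.length_ne_top

end DimOne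

/-! ### Lengths bounded on finitely generated submodules -/

section Sup

variable {R : Type*} [Ring R] {X : Type*} [AddCommGroup X] [Module R X]

/-- Every chain of submodules of length `k` ends above a finitely generated submodule of length
`≥ k` (pick one element in each layer). [folklore] -/
theorem exists_fg_le_length_of_ltSeries (k : ℕ) :
    ∀ p : LTSeries (Submodule R X), p.length = k →
      ∃ F : Submodule R X, F ≤ p.last ∧ F.FG ∧ (k : ℕ∞) ≤ Module.length R F := by
  induction k with
  | zero => exact fun p _ ↦ ⟨⊥, bot_le, Submodule.fg_bot, by simp⟩
  | succ k ih =>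
    intro p hp
    have hp0 : p.length ≠ 0 := by omega
    obtain ⟨F, hFle, hFfg, hkF⟩ := ih p.eraseLast (by simp [hp])
    have hlt : p.eraseLast.last < p.last := p.eraseLast_last_rel_last hp0
    obtain ⟨x, hxlast, hxnot⟩ := SetLike.exists_of_lt hlt
    refine ⟨F ⊔ R ∙ x, sup_le (hFle.trans hlt.le)
      ((Submodule.span_singleton_le_iff_mem _ _).mpr hxlast),
      hFfg.sup (Submodule.fg_span_singleton x), ?_⟩
    have hFlt : F < F ⊔ R ∙ x := lt_of_le_of_ne le_sup_left fun heq ↦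
      hxnot (hFle (heq ▸ Submodule.mem_sup_right (Submodule.mem_span_singleton_self x)))
    rw [Module.length_submodule] at hkF ⊢
    by_cases htop : Order.height F = ⊤
    · have hle := Order.height_mono hFlt.le
      rw [htop, top_le_iff] at hle
      rw [hle]
      exact le_top
    · have hlt' := Order.height_strictMono hFlt (lt_top_iff_ne_top.mpr htop)
      push_cast
      exact (ENat.coe_add_one_le_iff).mpr (hkF.trans_lt hlt')

/-- If every finitely generated submodule of `X` has length `≤ c`, then `length X ≤ c`.
[folklore] -/
theorem length_le_of_forall_fg {c : ℕ∞}
    (h : ∀ F : Submodule R X, F.FG → Module.length R F ≤ c) : Module.length R X ≤ c := by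
  rw [Module.length_eq_height]
  refine Order.height_le_iff.mpr fun p _ ↦ ?_
  obtain ⟨F, -, hF, hk⟩ := exists_fg_le_length_of_ltSeries p.length p rfl
  exact hk.trans (h F hF)

end Sup


/-! ### Akizuki's lemma: `length (M ⧸ aM) ≤ r • length (A ⧸ aA)` -/

section Akizuki

/-- A non-zero element of a domain `A` acts injectively on any `A`-module embedding in a vector
space over the fraction field `K`. [folklore] -/
lemma isSMulRegular_of_injective {A : Type*} [CommRing A] [IsDomain A]
    (K : Type*) [Field K] [Algebra A K] [IsFractionRing A K]
    {V : Type*} [AddCommGroup V] [Module K V] [Module A V] [IsScalarTower A K V]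
    {N : Type*} [AddCommGroup N] [Module A N] (g : N →ₗ[A] V)
    (hg : Function.Injective g) {a : A} (ha : a ≠ 0) : IsSMulRegular N a := by
  intro x y hxy
  apply hg
  have h : a • g x = a • g y := by
    rw [← map_smul, ← map_smul]
    exact congrArg g hxy
  rw [← algebraMap_smul K a (g x), ← algebraMap_smul K a (g y)] at h
  have ha' : algebraMap A K a ≠ 0 := fun h0 ↦ ha ((IsFractionRing.to_map_eq_zero_iff (K := K)).mp h0)
  exact smul_right_injective V ha' h

variable {A : Type*} [CommRing A] [IsDomain A] [IsNoetherianRing A] [Ring.DimensionLEOne A]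
  {K : Type*} [Field K] [Algebra A K] [IsFractionRing A K]
  {V : Type*} [AddCommGroup V] [Module K V] [Module A V] [IsScalarTower A K V]
  [FiniteDimensional K V]

variable (K) in
/-- **Akizuki's lemma, finitely generated case** (Matsumura, *Commutative Ring Theory*, Lemma in
the proof of Thm. 11.7): if `A` is a one-dimensional Noetherian domain with fraction field `K`
and `N` is a finitely generated `A`-module embedding in a finite-dimensional `K`-vector space `V`
(i.e. torsion-free of rank `≤ r = dim_K V`), then `length (N ⧸ aN) ≤ r • length (A ⧸ aA)` for
every `a ≠ 0`. [cite: Matsumura1987, Thm. 11.7 (Lemma)] -/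
theorem length_quot_smul_top_le_of_finite {N : Type*} [AddCommGroup N] [Module A N]
    [Module.Finite A N] (g : N →ₗ[A] V) (hg : Function.Injective g) {a : A} (ha : a ≠ 0) :
    Module.length A (N ⧸ (a • ⊤ : Submodule A N)) ≤
      Module.finrank K V * Module.length A (A ⧸ Ideal.span {a}) := by
  classical
  obtain ⟨m, v, hv⟩ := Module.Finite.exists_fin (R := A) (M := N)
  obtain ⟨s, hli, hmax⟩ := exists_maximal_linearIndepOn A v
  -- the free submodule `E` spanned by a maximal independent subfamily of the generators
  let E : Submodule A N := Submodule.span A (Set.range fun i : s ↦ v i)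
  have hEeq : Submodule.span A (v '' s) = E := by rw [Set.image_eq_range]
  let b : Basis s A E := Basis.span hli
  -- `card s ≤ dim_K V`
  have hcard : Fintype.card s ≤ Module.finrank K V := by
    have h1 : LinearIndependent A (g ∘ fun i : s ↦ v i) :=
      hli.map' g (LinearMap.ker_eq_bot.mpr hg)
    have h2 : LinearIndependent K (g ∘ fun i : s ↦ v i) :=
      (LinearIndependent.iff_fractionRing A K).mp h1
    exact h2.fintype_card_le_finrank
  -- `t ≠ 0` with `t • N ⊆ E`
  choose! c hc0 hcmem using hmax
  let t : A := ∏ i ∈ Finset.univ.filter (· ∉ s), c i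
  have ht0 : t ≠ 0 := Finset.prod_ne_zero_iff.mpr fun i hi ↦ hc0 i (Finset.mem_filter.mp hi).2
  have htv : ∀ i, t • v i ∈ E := by
    intro i
    by_cases hi : i ∈ s
    · exact Submodule.smul_mem _ _ (Submodule.subset_span ⟨⟨i, hi⟩, rfl⟩)
    · have hi' : i ∈ Finset.univ.filter (· ∉ s) := Finset.mem_filter.mpr ⟨Finset.mem_univ _, hi⟩
      change (∏ i ∈ Finset.univ.filter (· ∉ s), c i) • v i ∈ E
      rw [← Finset.mul_prod_erase _ _ hi', mul_comm, mul_smul, ← hEeq]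
      exact Submodule.smul_mem _ _ (hcmem i hi)
  have htN : ∀ x : N, t • x ∈ E := by
    intro x
    have hx : x ∈ Submodule.span A (Set.range v) := by rw [hv]; exact Submodule.mem_top
    induction hx using Submodule.span_induction with
    | mem x hx => obtain ⟨i, rfl⟩ := hx; exact htv i
    | zero => rw [smul_zero]; exact E.zero_mem
    | add x y _ _ hx hy => rw [smul_add]; exact E.add_mem hx hy
    | smul r x _ hx => rw [smul_comm]; exact E.smul_mem r hx
  -- the cokernel `N ⧸ E` has finite length: it is a quotient of `A^m ⧸ t A^m`
  have hC : Module.length A (N ⧸ E) ≠ ⊤ := by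
    let π : (Fin m →₀ A) →ₗ[A] N ⧸ E := E.mkQ ∘ₗ Finsupp.linearCombination A v
    have hπ : Function.Surjective π := by
      refine (Submodule.mkQ_surjective E).comp ?_
      rw [← LinearMap.range_eq_top, Finsupp.range_linearCombination, hv]
    have hker : (t • ⊤ : Submodule A (Fin m →₀ A)) ≤ LinearMap.ker π := by
      intro f hf
      obtain ⟨f', rfl⟩ := (mem_smul_top_iff t f).mp hf
      rw [LinearMap.mem_ker, map_smul]
      change E.mkQ (t • Finsupp.linearCombination A v f') = 0
      rw [Submodule.mkQ_apply, Submodule.Quotient.mk_eq_zero]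
      exact htN _
    have hψ : Function.Surjective ((t • ⊤ : Submodule A (Fin m →₀ A)).liftQ π hker) := by
      rw [← LinearMap.range_eq_top, Submodule.range_liftQ, LinearMap.range_eq_top]
      exact hπ
    refine ne_top_of_le_ne_top ?_ (Module.length_le_of_surjective _ hψ)
    rw [length_quot_smul_top_of_free (Finsupp.basisSingleOne) t, Nat.card_eq_fintype_card,
      Fintype.card_fin]
    exact WithTop.mul_ne_top (ENat.coe_ne_top m) (length_quot_span_singleton_ne_top ht0)
  -- Akizuki's inequality for `E ⊆ N`
  have hreg : IsSMulRegular N a := isSMulRegular_of_injective K g hg ha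
  have hregE : IsSMulRegular E a :=
    isSMulRegular_of_injective K (g ∘ₗ E.subtype) (hg.comp Subtype.val_injective) ha
  have hC' : Module.length A (N ⧸ LinearMap.range E.subtype) ≠ ⊤ := by
    rwa [(Submodule.quotEquivOfEq _ _ (Submodule.range_subtype E)).length_eq]
  refine (length_quot_smul_top_le_of_finite_coker E.subtype hreg hregE hC').trans ?_
  rw [length_quot_smul_top_of_free b a, Nat.card_eq_fintype_card]
  gcongr

variable (K) in
/-- **Akizuki's lemma** (Matsumura, *Commutative Ring Theory*, Lemma in the proof of
Thm. 11.7): if `A` is a one-dimensional Noetherian domain with fraction field `K` and `M` is any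
`A`-module embedding in a finite-dimensional `K`-vector space `V` (i.e. torsion-free of finite
rank `≤ r = dim_K V`), then `length (M ⧸ aM) ≤ r • length (A ⧸ aA)` for every `a ≠ 0`; in
particular `M ⧸ aM` has finite length. (Reduction to the finitely generated case: every finitely
generated submodule of `M ⧸ aM` is the image of `N ⧸ aN` for a finitely generated `N ⊆ M`.)
[cite: Matsumura1987, Thm. 11.7 (Lemma)] -/
theorem length_quot_smul_top_le {M : Type*} [AddCommGroup M] [Module A M]
    (g : M →ₗ[A] V) (hg : Function.Injective g) {a : A} (ha : a ≠ 0) :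
    Module.length A (M ⧸ (a • ⊤ : Submodule A M)) ≤
      Module.finrank K V * Module.length A (A ⧸ Ideal.span {a}) := by
  classical
  refine length_le_of_forall_fg fun F hF ↦ ?_
  obtain ⟨S, hS⟩ := hF
  choose l hl using fun y : M ⧸ (a • ⊤ : Submodule A M) ↦ Submodule.Quotient.mk_surjective _ y
  let N₁ : Submodule A M := Submodule.span A (l '' (S : Set (M ⧸ (a • ⊤ : Submodule A M))))
  haveI : Module.Finite A N₁ :=
    Module.Finite.iff_fg.mpr (Submodule.fg_span (S.finite_toSet.image l))
  have hN₁ := length_quot_smul_top_le_of_finite K (g ∘ₗ N₁.subtype)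
    (hg.comp Subtype.val_injective) ha
  -- `F ≤ image of N₁`
  let q := (a • ⊤ : Submodule A M).mkQ
  have hFle : F ≤ N₁.map q := by
    rw [← hS, Submodule.span_le]
    intro y hy
    exact ⟨l y, Submodule.subset_span (Set.mem_image_of_mem l hy), hl y⟩
  -- the surjection `N₁ ⧸ a N₁ → N₁.map q`
  let φ : N₁ →ₗ[A] N₁.map q := q.submoduleMap N₁
  have hφ : Function.Surjective φ := q.submoduleMap_surjective N₁
  have hker : (a • ⊤ : Submodule A N₁) ≤ LinearMap.ker φ := by
    intro n hn
    obtain ⟨n', rfl⟩ := (mem_smul_top_iff a n).mp hn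
    rw [LinearMap.mem_ker, map_smul]
    refine Subtype.ext ?_
    change (a • φ n' : M ⧸ (a • ⊤ : Submodule A M)) = 0
    rw [LinearMap.submoduleMap_coe_apply, Submodule.mkQ_apply, ← Submodule.Quotient.mk_smul,
      Submodule.Quotient.mk_eq_zero]
    exact Submodule.smul_mem_pointwise_smul _ a ⊤ Submodule.mem_top
  have hψ : Function.Surjective ((a • ⊤ : Submodule A N₁).liftQ φ hker) := by
    rw [← LinearMap.range_eq_top, Submodule.range_liftQ, LinearMap.range_eq_top]
    exact hφ
  calc Module.length A F ≤ Module.length A (N₁.map q) :=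
        Module.length_le_of_injective _ (Submodule.inclusion_injective hFle)
    _ ≤ Module.length A (N₁ ⧸ (a • ⊤ : Submodule A N₁)) := Module.length_le_of_surjective _ hψ
    _ ≤ _ := hN₁

end Akizuki

/-! ### The Krull–Akizuki theorem -/

section Main

variable {A : Type*} [CommRing A] [IsDomain A] [IsNoetherianRing A] [Ring.DimensionLEOne A]
  {K : Type*} [Field K] [Algebra A K] [IsFractionRing A K]
  {L : Type*} [Field L] [Algebra K L] [FiniteDimensional K L] [Algebra A L] [IsScalarTower A K L]
  (B : Subalgebra A L)

omit [IsNoetherianRing A] [Ring.DimensionLEOne A] in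
include K in
/-- Every non-zero `b` in an intermediate ring `A ⊆ B ⊆ L` (`L / Frac A` finite) has a non-zero
multiple `a₀ ∈ A ∩ bB` (constant term of an algebraic relation). [folklore] -/
lemma exists_algebraMap_mem_span_singleton {b : B} (hb : b ≠ 0) :
    ∃ a₀ : A, a₀ ≠ 0 ∧ algebraMap A B a₀ ∈ Ideal.span {b} := by
  have h1 : IsAlgebraic K (b : L) := Algebra.IsAlgebraic.isAlgebraic (b : L)
  have h2 : IsAlgebraic A (b : L) := (IsFractionRing.isAlgebraic_iff A K L).mpr h1
  have h3 : IsAlgebraic A b := (isAlgebraic_algHom_iff B.val Subtype.val_injective).mp h2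
  obtain ⟨q, hq0, hq⟩ := h3.exists_nonzero_coeff_and_aeval_eq_zero
    (mem_nonZeroDivisors_of_ne_zero hb)
  refine ⟨q.coeff 0, hq0, ?_⟩
  have := congrArg (Polynomial.aeval b) (Polynomial.X_mul_divX_add q)
  rw [hq, map_add, map_mul, Polynomial.aeval_X, Polynomial.aeval_C] at this
  rw [Ideal.mem_span_singleton']
  exact ⟨-Polynomial.aeval b q.divX, by linear_combination -this⟩

include K in
/-- `B ⧸ aB` has finite `A`-length for `a ≠ 0` (Akizuki's lemma with `V = L`). [folklore] -/
lemma length_quot_smul_top_ne_top {a : A} (ha : a ≠ 0) :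
    Module.length A (B ⧸ (a • ⊤ : Submodule A B)) ≠ ⊤ := by
  refine ne_top_of_le_ne_top ?_
    (length_quot_smul_top_le K (V := L) B.val.toLinearMap Subtype.val_injective ha)
  exact WithTop.mul_ne_top (ENat.coe_ne_top _) (length_quot_span_singleton_ne_top ha)

include K in
/-- If the ideal `J` of `B` contains a non-zero `a ∈ A`, then `B ⧸ J` has finite `A`-length.
[folklore] -/
lemma length_quot_ne_top_of_mem {J : Ideal B} {a : A} (ha : a ≠ 0) (haJ : algebraMap A B a ∈ J) :
    Module.length A (B ⧸ J) ≠ ⊤ := by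
  have hle : (a • ⊤ : Submodule A B) ≤ J.restrictScalars A := by
    intro x hx
    obtain ⟨y, rfl⟩ := (mem_smul_top_iff a x).mp hx
    change a • y ∈ J
    rw [Algebra.smul_def]
    exact J.mul_mem_right _ haJ
  refine ne_top_of_le_ne_top (length_quot_smul_top_ne_top (K := K) B ha) ?_
  rw [← (Submodule.Quotient.restrictScalarsEquiv A J).length_eq]
  exact Module.length_le_of_surjective _ (Submodule.factor_surjective hle)

end Main


end KrullAkizuki

/-- **The Krull–Akizuki theorem** (Matsumura, *Commutative Ring Theory*, Thm. 11.7): for a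
one-dimensional Noetherian domain `A` with fraction field `K`, a finite extension `L / K` and a
ring `A ⊆ B ⊆ L`, the ring `B` is Noetherian of dimension `≤ 1` and `B ⧸ J` has finite `A`-length
for every non-zero ideal `J`. This discharges the named fact `Literature.RingTheory.DiscreteValuationRing.KrullAkizuki`. Proof
(Akizuki, in the linear-algebra formulation of Bourbaki, as in Matsumura): every non-zero ideal
`J` contains a non-zero `a ∈ A` (`KrullAkizuki.exists_algebraMap_mem_span_singleton`), and
`B ⧸ aB` has finite `A`-length by Akizuki's lemma (`KrullAkizuki.length_quot_smul_top_le`, with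
`V = L`); hence `B ⧸ J` has finite length, `J ⧸ aB` is finitely generated (so `J` is), and for
`J = P` prime `B ⧸ P` is an Artinian domain, i.e. a field. (The hypothesis `¬ IsField A` of the
named fact is not needed.) [cite: Matsumura1987, Thm. 11.7] -/
theorem KrullAkizuki_holds : KrullAkizuki.{u, v, w} := by
  intro A _ _ _ _ hA K _ _ _ L _ _ _ _ _ B
  -- every non-zero ideal contains a non-zero element of `A`
  have key : ∀ J : Ideal B, J ≠ ⊥ → ∃ a : A, a ≠ 0 ∧ algebraMap A B a ∈ J := by
    intro J hJ
    obtain ⟨b, hbJ, hb0⟩ := J.ne_bot_iff.mp hJ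
    obtain ⟨a, ha, haJ⟩ := KrullAkizuki.exists_algebraMap_mem_span_singleton (K := K) B hb0
    exact ⟨a, ha, (Ideal.span_singleton_le_iff_mem J).mpr hbJ haJ⟩
  have hfl : ∀ J : Ideal B, J ≠ ⊥ → IsFiniteLength A (B ⧸ J) := by
    intro J hJ
    obtain ⟨a, ha, haJ⟩ := key J hJ
    exact Module.length_ne_top_iff.mp (KrullAkizuki.length_quot_ne_top_of_mem (K := K) B ha haJ)
  refine ⟨?_, ⟨fun {P} hP hPp ↦ ?_⟩, hfl⟩
  · -- Noetherian
    refine (isNoetherianRing_iff_ideal_fg B).mpr fun J ↦ ?_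
    by_cases hJ : J = ⊥
    · rw [hJ]; exact Submodule.fg_bot
    obtain ⟨a, ha, haJ⟩ := key J hJ
    let I₀ : Ideal B := Ideal.span {algebraMap A B a}
    have hI₀J : I₀ ≤ J := (Ideal.span_singleton_le_iff_mem J).mpr haJ
    haveI : IsNoetherian A (B ⧸ I₀) :=
      (isFiniteLength_iff_isNoetherian_isArtinian.mp (Module.length_ne_top_iff.mp
        (KrullAkizuki.length_quot_ne_top_of_mem (K := K) B ha (Ideal.mem_span_singleton_self _)))).1
    refine Submodule.fg_of_fg_map_of_fg_inf_ker I₀.mkQ ?_ ?_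
    · exact Submodule.FG.of_restrictScalars A (IsNoetherian.noetherian _)
    · rw [Submodule.ker_mkQ, inf_eq_right.mpr hI₀J]
      exact ⟨{algebraMap A B a}, by simp [I₀]⟩
  · -- dimension ≤ 1
    haveI := hPp
    haveI : IsArtinian A (B ⧸ P) := (isFiniteLength_iff_isNoetherian_isArtinian.mp (hfl P hP)).2
    haveI : IsArtinianRing (B ⧸ P) := isArtinian_of_tower A ‹IsArtinian A (B ⧸ P)›
    exact Ideal.Quotient.maximal_of_isField _ (IsArtinianRing.isField_of_isDomain _)


end Literature.RingTheory.DiscreteValuationRing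

/-! ## Part II. The Deligne–Serre lifting lemma -/

open IsLocalRing

namespace Literature.RingTheory.DiscreteValuationRing.DeligneSerre1974

/-! ### Common eigenvectors with a prescribed character -/

section Eigenvector

variable {R : Type*} [CommRing R] {L : Type*} [Field L] [Algebra R L]
  {M : Type*} [AddCommGroup M] [Module R M]
  {H : Type*} [CommRing H] [Algebra R H]

/-- Mathlib's `LinearMap.tensorProductEnd : L ⊗ End_R M → End_L (L ⊗ M)` on pure tensors:
`l ⊗ f ↦ l • f_L`. [folklore] -/
lemma tensorProductEnd_tmul (l : L) (f : Module.End R M) :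
    LinearMap.tensorProductEnd R L M (l ⊗ₜ f) = l • f.baseChange L := by
  change LinearMap.tensorProduct R L M M (l ⊗ₜ f) = _
  simp only [LinearMap.tensorProduct, TensorProduct.AlgebraTensorModule.lift_apply,
    TensorProduct.lift.tmul, LinearMap.coe_restrictScalars, LinearMap.coe_mk, AddHom.coe_mk,
    LinearMap.baseChangeHom_apply, LinearMap.smul_apply]

/-- The `L`-algebra map `L ⊗[R] H → End_L (L ⊗[R] M)` induced by `ι : H → End_R M`
(base change of the action of `H` on `M`). [folklore] -/
noncomputable def actL (L : Type*) [Field L] [Algebra R L] (ι : H →ₐ[R] Module.End R M) :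
    L ⊗[R] H →ₐ[L] Module.End L (L ⊗[R] M) :=
  (LinearMap.tensorProductEnd R L M).comp (Algebra.TensorProduct.map (AlgHom.id L L) ι)

/-- `actL` on pure tensors: `l ⊗ h` acts as `l • (ι h)_L`. [folklore] -/
lemma actL_tmul (ι : H →ₐ[R] Module.End R M) (l : L) (h : H) :
    actL L ι (l ⊗ₜ h) = l • (ι h).baseChange L := by
  simp only [actL, AlgHom.coe_comp, Function.comp_apply, Algebra.TensorProduct.map_tmul,
    AlgHom.coe_id, id_eq, tensorProductEnd_tmul]

/-- For the base change `M → L ⊗ M`, `IsBaseChange.endHom f` is `f.baseChange L`. [folklore] -/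
lemma endHom_eq_baseChange (f : Module.End R M) :
    (TensorProduct.isBaseChange R M L).endHom f = f.baseChange L := by
  refine LinearMap.ext fun x ↦ ?_
  induction x using TensorProduct.induction_on with
  | zero => simp
  | add x y hx hy => simp [hx, hy]
  | tmul l m =>
    have : l ⊗ₜ[R] m = l • ((TensorProduct.mk R L M 1) m) := by
      simp [TensorProduct.smul_tmul']
    rw [this, map_smul, map_smul, IsBaseChange.endHom_comp_apply]
    simp

/-- For `M` finite free, `LinearMap.tensorProductEnd` agrees with the base-change isomorphism
`L ⊗ End_R M ≃ End_L (L ⊗ M)` (`IsBaseChange.end`). [folklore] -/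
lemma tensorProductEnd_eq_equiv [Module.Free R M] [Module.Finite R M]
    (x : L ⊗[R] Module.End R M) :
    LinearMap.tensorProductEnd R L M x = ((TensorProduct.isBaseChange R M L).end).equiv x := by
  induction x using TensorProduct.induction_on with
  | zero => simp only [map_zero]
  | add x y hx hy => simp only [map_add, hx, hy]
  | tmul l f =>
    rw [IsBaseChange.equiv_tmul, tensorProductEnd_tmul, endHom_eq_baseChange]

/-- For `M` finite free, `L ⊗ End_R M → End_L (L ⊗ M)` is injective (indeed bijective).
[folklore] -/
lemma tensorProductEnd_injective [Module.Free R M] [Module.Finite R M] :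
    Function.Injective (LinearMap.tensorProductEnd R L M) := by
  intro x y hxy
  rw [tensorProductEnd_eq_equiv, tensorProductEnd_eq_equiv] at hxy
  exact ((TensorProduct.isBaseChange R M L).end).equiv.injective hxy

/-- If `H` acts faithfully on the finite free module `M` and `L` is flat over `R`, then `L ⊗ H`
acts faithfully on `L ⊗ M`. [folklore] -/
lemma actL_injective [Module.Free R M] [Module.Finite R M] [Module.Flat R L]
    {ι : H →ₐ[R] Module.End R M} (hι : Function.Injective ι) :
    Function.Injective (actL L ι) := by
  have h1 : Function.Injective (Algebra.TensorProduct.map (AlgHom.id L L) ι) := by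
    have := Module.Flat.lTensor_preserves_injective_linearMap (M := L) ι.toLinearMap hι
    have e : ∀ z : L ⊗[R] H, Algebra.TensorProduct.map (AlgHom.id L L) ι z =
        LinearMap.lTensor L ι.toLinearMap z := fun z ↦ by
      induction z using TensorProduct.induction_on with
      | zero => simp only [map_zero]
      | add x y hx hy => simp only [map_add, hx, hy]
      | tmul l h => simp
    intro x y hxy
    apply this
    rwa [← e, ← e]
  exact tensorProductEnd_injective.comp h1

/-- The `L`-linear extension `L ⊗[R] H → L` of a character `π : H → L`. [folklore] -/
noncomputable def charL (π : H →ₐ[R] L) : L ⊗[R] H →ₐ[L] L :=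
  Algebra.TensorProduct.lift (AlgHom.id L L) π fun _ _ ↦ Commute.all _ _

/-- `charL π` on pure tensors: `l ⊗ h ↦ l · π(h)`. [folklore] -/
lemma charL_tmul (π : H →ₐ[R] L) (l : L) (h : H) : charL π (l ⊗ₜ h) = l * π h := by
  simp [charL]

/-- **Common eigenvectors with prescribed character.** If a commutative `R`-algebra `H`, finite
as an `R`-module, acts faithfully on a finite free `R`-module `M` and `L` is a field flat over
`R`, then every character `π : H → L` occurs on a common eigenvector of `H` in `L ⊗[R] M`.
(The kernel `P` of `L ⊗ π : L ⊗ H → L` is a maximal ideal of the artinian ring `L ⊗ H`, hence a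
minimal prime; `L ⊗ H` acts faithfully on `L ⊗ M` by flatness, so `P` is a minimal prime of
the annihilator, hence an associated prime: `P = Ann(v)` for some `v`.) This is the step
"`𝔭` premier minimal … est associé à `M`" of Deligne–Serre's proof, after base change to a field.
[cite: DeligneSerreASENS1974, Lemme 6.11 (proof)] -/
theorem exists_eigenvector_of_character [Module.Free R M] [Module.Finite R M] [Module.Flat R L]
    [Module.Finite R H] {ι : H →ₐ[R] Module.End R M} (hι : Function.Injective ι)
    (π : H →ₐ[R] L) :
    ∃ v : L ⊗[R] M, v ≠ 0 ∧ ∀ h : H, (ι h).baseChange L v = π h • v := by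
  classical
  haveI : IsArtinianRing (L ⊗[R] H) := IsArtinianRing.of_finite L (L ⊗[R] H)
  have hΦ : Function.Injective (actL L ι) := actL_injective hι
  letI : Module (L ⊗[R] H) (L ⊗[R] M) := Module.compHom (L ⊗[R] M) (actL L ι).toRingHom
  have hsmul : ∀ (a : L ⊗[R] H) (v : L ⊗[R] M), a • v = actL L ι a v := fun _ _ ↦ rfl
  haveI : IsScalarTower L (L ⊗[R] H) (L ⊗[R] M) := ⟨fun l a v ↦ by simp [hsmul]⟩
  haveI : Module.Finite (L ⊗[R] H) (L ⊗[R] M) :=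
    Module.Finite.of_restrictScalars_finite L (L ⊗[R] H) (L ⊗[R] M)
  -- the character and its kernel `P`, a maximal ideal
  have hχ : Function.Surjective (charL π) := fun l ↦
    ⟨algebraMap L (L ⊗[R] H) l, AlgHom.commutes _ l⟩
  haveI hPmax : (RingHom.ker (charL π)).IsMaximal := RingHom.ker_isMaximal_of_surjective _ hχ
  -- `L ⊗ M` is faithful, so `P` is a minimal prime of its annihilator, hence associated
  have hann : Module.annihilator (L ⊗[R] H) (L ⊗[R] M) = ⊥ := by
    refine le_bot_iff.mp fun a ha ↦ ?_
    rw [Module.mem_annihilator] at ha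
    exact hΦ ((LinearMap.ext fun v ↦ ha v).trans (map_zero (actL L ι)).symm)
  have hPmin : RingHom.ker (charL π) ∈
      (Module.annihilator (L ⊗[R] H) (L ⊗[R] M)).minimalPrimes := by
    rw [hann]
    exact IsArtinianRing.mem_minimalPrimes bot_le
  have hPass : IsAssociatedPrime (RingHom.ker (charL π)) (L ⊗[R] M) :=
    Module.associatedPrimes.minimalPrimes_annihilator_subset_associatedPrimes _ _ hPmin
  obtain ⟨v, hv⟩ := (isAssociatedPrime_iff.mp hPass).2
  refine ⟨v, ?_, fun h ↦ ?_⟩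
  · rintro rfl
    apply hPmax.ne_top
    rw [hv, Submodule.colon_singleton_zero]
  · have hmem : (1 : L) ⊗ₜ[R] h - algebraMap L (L ⊗[R] H) (π h) ∈ RingHom.ker (charL π) := by
      rw [RingHom.mem_ker, map_sub, charL_tmul, AlgHom.commutes, one_mul]
      simp
    rw [hv, Submodule.mem_colon_singleton, Submodule.mem_bot, sub_smul, sub_eq_zero,
      hsmul, hsmul, actL_tmul, one_smul, AlgHom.commutes] at hmem
    simpa using hmem

end Eigenvector

/-! ### Descent of eigenvectors from `Frac(𝒪') ⊗ M` to `𝒪' ⊗ M` -/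

section Descent

variable {R : Type*} [CommRing R] {O' : Type*} [CommRing O'] [Algebra R O']
  {L : Type*} [Field L] [Algebra R L] [Algebra O' L] [IsScalarTower R O' L]
  {M : Type*} [AddCommGroup M] [Module R M]

variable (R O' L M) in
/-- The comparison map `O' ⊗[R] M → L ⊗[R] M` (used with `L = Frac O'`). [folklore] -/
noncomputable def toFrac : O' ⊗[R] M →ₗ[R] L ⊗[R] M :=
  LinearMap.rTensor M (IsScalarTower.toAlgHom R O' L).toLinearMap

/-- `toFrac` on pure tensors. [folklore] -/
@[simp] lemma toFrac_tmul (o : O') (m : M) :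
    toFrac R O' L M (o ⊗ₜ m) = algebraMap O' L o ⊗ₜ m := by
  simp [toFrac]

/-- `toFrac` is `O'`-semilinear for `O' → L`. [folklore] -/
lemma toFrac_smul (b : O') (x : O' ⊗[R] M) :
    toFrac R O' L M (b • x) = algebraMap O' L b • toFrac R O' L M x := by
  induction x using TensorProduct.induction_on with
  | zero => simp
  | add x y hx hy => simp only [smul_add, map_add, hx, hy]
  | tmul o m =>
    simp only [TensorProduct.smul_tmul', toFrac_tmul, smul_eq_mul, map_mul]

/-- `toFrac` commutes with the base changes of an endomorphism of `M`. [folklore] -/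
lemma toFrac_baseChange (T : Module.End R M) (x : O' ⊗[R] M) :
    toFrac R O' L M (T.baseChange O' x) = T.baseChange L (toFrac R O' L M x) := by
  induction x using TensorProduct.induction_on with
  | zero => simp
  | add x y hx hy => simp only [map_add, hx, hy]
  | tmul o m => simp

/-- `O' ⊗ M → Frac(O') ⊗ M` is injective when `M` is flat over `R`. [folklore] -/
lemma toFrac_injective [IsFractionRing O' L] [Module.Flat R M] :
    Function.Injective (toFrac R O' L M) :=
  Module.Flat.rTensor_preserves_injective_linearMap _ (IsFractionRing.injective O' L)

variable [IsDomain O'] [IsFractionRing O' L]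

/-- Clearing denominators: every `v ∈ Frac(O') ⊗ M` has a non-zero multiple `s • v`, `s ∈ O'`,
in the image of `O' ⊗ M`. [folklore] -/
lemma exists_toFrac_eq_smul (v : L ⊗[R] M) :
    ∃ s : O', s ≠ 0 ∧ ∃ x : O' ⊗[R] M, toFrac R O' L M x = algebraMap O' L s • v := by
  induction v using TensorProduct.induction_on with
  | zero => exact ⟨1, one_ne_zero, 0, by simp⟩
  | add v w hv hw =>
    obtain ⟨s, hs, x, hx⟩ := hv
    obtain ⟨t, ht, y, hy⟩ := hw
    refine ⟨s * t, mul_ne_zero hs ht, t • x + s • y, ?_⟩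
    rw [map_add, toFrac_smul, toFrac_smul, hx, hy, smul_add, map_mul, mul_smul, mul_smul,
      smul_comm (algebraMap O' L s) (algebraMap O' L t) v]
  | tmul l m =>
    obtain ⟨c, s, hs, rfl⟩ := IsFractionRing.div_surjective (A := O') l
    have hs' : algebraMap O' L s ≠ 0 :=
      IsFractionRing.to_map_ne_zero_of_mem_nonZeroDivisors hs
    refine ⟨s, nonZeroDivisors.ne_zero hs, c ⊗ₜ m, ?_⟩
    rw [toFrac_tmul, TensorProduct.smul_tmul', smul_eq_mul, mul_div_cancel₀ _ hs']

/-- **Descent of eigenvectors to the valuation ring.** A common eigenvector in `L ⊗[R] M`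
(`L = Frac O'`, `M` flat over `R`) of a family of endomorphisms `T i` of `M`, whose eigenvalues
lie in `O'`, can be rescaled into `O' ⊗[R] M`. [cite: DeligneSerreASENS1974, Lemme 6.11 (proof)] -/
theorem exists_eigenvector_descend [Module.Flat R M] {ι₀ : Type*} (T : ι₀ → Module.End R M)
    (a' : ι₀ → O') {v : L ⊗[R] M} (hv : v ≠ 0)
    (heig : ∀ i, (T i).baseChange L v = algebraMap O' L (a' i) • v) :
    ∃ f' : O' ⊗[R] M, f' ≠ 0 ∧ ∀ i, (T i).baseChange O' f' = a' i • f' := by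
  obtain ⟨s, hs, x, hx⟩ := exists_toFrac_eq_smul (R := R) (O' := O') v
  have hs' : algebraMap O' L s ≠ 0 :=
    fun h ↦ hs (IsFractionRing.injective O' L (h.trans (map_zero _).symm))
  refine ⟨x, ?_, fun i ↦ toFrac_injective (L := L) ?_⟩
  · rintro rfl
    rw [map_zero, eq_comm, smul_eq_zero] at hx
    exact hx.elim hs' hv
  · rw [toFrac_baseChange, toFrac_smul, hx, map_smul, heig i, smul_comm]

end Descent

/-! ### The character of a common eigenvector -/

section Character

variable {R : Type*} [CommRing R] {k : Type*} [Field k] [Algebra R k]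
  {M : Type*} [AddCommGroup M] [Module R M]

variable (R M) in
/-- The subalgebra of endomorphisms of `M` having the vector `f ∈ k ⊗[R] M` as an eigenvector
after base change to `k`. [folklore] -/
noncomputable def eigenSubalgebra (f : k ⊗[R] M) : Subalgebra R (Module.End R M) where
  carrier := {h | ∃ c : k, h.baseChange k f = c • f}
  mul_mem' := by
    rintro g h ⟨c, hc⟩ ⟨d, hd⟩
    refine ⟨c * d, ?_⟩
    rw [LinearMap.baseChange_mul, Module.End.mul_apply, hd, map_smul, hc, smul_smul, mul_comm]
  one_mem' := ⟨1, by rw [LinearMap.baseChange_one, Module.End.one_apply, one_smul]⟩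
  add_mem' := by
    rintro g h ⟨c, hc⟩ ⟨d, hd⟩
    exact ⟨c + d, by rw [LinearMap.baseChange_add, LinearMap.add_apply, hc, hd, add_smul]⟩
  zero_mem' := ⟨0, by rw [LinearMap.baseChange_zero, LinearMap.zero_apply, zero_smul]⟩
  algebraMap_mem' r := ⟨algebraMap R k r, by
    rw [Algebra.algebraMap_eq_smul_one, LinearMap.baseChange_smul, LinearMap.baseChange_one,
      LinearMap.smul_apply, Module.End.one_apply, algebraMap_smul]⟩

/-- Membership in `eigenSubalgebra R M f`. [folklore] -/
lemma mem_eigenSubalgebra {f : k ⊗[R] M} {h : Module.End R M} :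
    h ∈ eigenSubalgebra R M f ↔ ∃ c : k, h.baseChange k f = c • f :=
  Iff.rfl

/-- **The eigencharacter.** If `f ≠ 0` in `k ⊗[R] M` is a common eigenvector of a set `𝒯` of
endomorphisms of `M`, with eigenvalues `a_T`, then on the subalgebra `R[𝒯] ≤ End_R M` there is
an `R`-algebra homomorphism `χ : R[𝒯] → k` with `h f = χ(h) f` for all `h`, and `χ(T) = a_T`
("l'application `h ↦ a_h` est un homomorphisme de `H` sur `k`").
[cite: DeligneSerreASENS1974, Lemme 6.11 (proof)] -/
theorem exists_eigenCharacter (𝒯 : Set (Module.End R M)) (a : Module.End R M → k)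
    {f : k ⊗[R] M} (hf : f ≠ 0) (heig : ∀ T ∈ 𝒯, T.baseChange k f = a T • f) :
    ∃ χ : Algebra.adjoin R 𝒯 →ₐ[R] k,
      (∀ h : Algebra.adjoin R 𝒯, (h : Module.End R M).baseChange k f = χ h • f) ∧
      ∀ (T : Module.End R M) (hT : T ∈ 𝒯), χ ⟨T, Algebra.subset_adjoin hT⟩ = a T := by
  have hle : Algebra.adjoin R 𝒯 ≤ eigenSubalgebra R M f :=
    Algebra.adjoin_le fun T hT ↦ ⟨a T, heig T hT⟩
  have hinj : Function.Injective fun c : k ↦ c • f := smul_left_injective k hf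
  choose c hc using fun h : Algebra.adjoin R 𝒯 ↦ (mem_eigenSubalgebra.mp (hle h.2))
  have huniq : ∀ (h : Algebra.adjoin R 𝒯) (d : k),
      (h : Module.End R M).baseChange k f = d • f → c h = d :=
    fun h d hd ↦ hinj ((hc h).symm.trans hd)
  refine ⟨{ toFun := c
            map_one' := huniq 1 1 (by simp)
            map_mul' := fun g h ↦ huniq _ _ (by
              rw [Subalgebra.coe_mul, LinearMap.baseChange_mul, Module.End.mul_apply, hc h,
                map_smul, hc g, smul_smul, mul_comm])
            map_zero' := huniq 0 0 (by simp)
            map_add' := fun g h ↦ huniq _ _ (by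
              rw [Subalgebra.coe_add, LinearMap.baseChange_add, LinearMap.add_apply, hc g, hc h,
                add_smul])
            commutes' := fun r ↦ huniq _ _ (by
              rw [Subalgebra.coe_algebraMap, Algebra.algebraMap_eq_smul_one,
                LinearMap.baseChange_smul, LinearMap.baseChange_one, LinearMap.smul_apply,
                Module.End.one_apply, algebraMap_smul]) }, fun h ↦ hc h, fun T hT ↦ ?_⟩
  exact huniq ⟨T, _⟩ (a T) (heig T hT)

end Character

/-! ### A discrete valuation ring centred on a closed point (Krull–Akizuki) -/

/-- **A discrete valuation ring dominating a closed point** (via Krull–Akizuki). Let `D` be a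
one-dimensional Noetherian domain with fraction field `K'` and `n` a maximal ideal of `D`. Then
there is a discrete valuation ring `𝒪'` with `D ⊆ 𝒪' ⊆ K'`, `Frac 𝒪' = K'`, whose maximal
ideal contracts to `n`: the localisation of the integral closure of `D` in `K'` (a Dedekind
domain by Krull–Akizuki) at a maximal ideal above `n` ("il existe donc un anneau de valuation
discrète `𝒪'` d'idéal maximal `𝔪'`, de corps des fractions `K'`, tel que `H/𝔭 ⊂ 𝒪'` et
`𝔪' ∩ H/𝔭 = 𝔪/𝔭`"). [cite: DeligneSerreASENS1974, Lemme 6.11 (proof)]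
[cite: Matsumura1987, Cor. to Thm. 11.7] -/
theorem exists_dvr_of_isMaximal (h : KrullAkizuki.{u, u, u})
    {R : Type u} [CommRing R] {D : Type u} [CommRing D] [IsDomain D] [Algebra R D]
    [IsNoetherianRing D] [Ring.DimensionLEOne D] (hD : ¬ IsField D)
    (n : Ideal D) [n.IsMaximal] :
    ∃ (𝒪' : Type u) (_ : CommRing 𝒪') (_ : IsDomain 𝒪') (_ : IsDiscreteValuationRing 𝒪')
      (_ : Algebra D 𝒪') (_ : Algebra R 𝒪') (_ : IsScalarTower R D 𝒪')
      (_ : Algebra 𝒪' (FractionRing D)) (_ : IsScalarTower D 𝒪' (FractionRing D))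
      (_ : IsScalarTower R 𝒪' (FractionRing D)) (_ : IsFractionRing 𝒪' (FractionRing D)),
      (maximalIdeal 𝒪').comap (algebraMap D 𝒪') = n := by
  haveI : IsDedekindDomain (integralClosure D (FractionRing D)) :=
    h.isDedekindDomain_integralClosure hD (FractionRing D) (FractionRing D)
  have hinj : Function.Injective (algebraMap D (integralClosure D (FractionRing D))) :=
    fun x y hxy ↦ IsFractionRing.injective D (FractionRing D) (congrArg Subtype.val hxy)
  obtain ⟨Q, hQmax, hQ⟩ := Ideal.exists_ideal_over_maximal_of_isIntegral
    (S := integralClosure D (FractionRing D)) n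
    (by rw [(RingHom.injective_iff_ker_eq_bot _).mp hinj]; exact bot_le)
  have hQne : Q ≠ ⊥ := by
    rintro rfl
    refine Ring.ne_bot_of_isMaximal_of_not_isField ‹n.IsMaximal› hD ?_
    rw [← hQ, Ideal.comap_bot_of_injective _ hinj]
  haveI := hQmax.isPrime
  let 𝒪' : Subalgebra (integralClosure D (FractionRing D)) (FractionRing D) :=
    Localization.subalgebra.ofField (FractionRing D) Q.primeCompl Q.primeCompl_le_nonZeroDivisors
  haveI : IsLocalization.AtPrime 𝒪' Q :=
    Localization.subalgebra.isLocalization_ofField (FractionRing D) _ _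
  haveI : IsDiscreteValuationRing 𝒪' :=
    IsLocalization.AtPrime.isDiscreteValuationRing_of_dedekind_domain _ hQne 𝒪'
  refine ⟨𝒪', inferInstance, inferInstance, inferInstance, inferInstance, inferInstance,
    inferInstance, inferInstance, inferInstance, inferInstance, inferInstance, ?_⟩
  have h1 := IsLocalization.AtPrime.under_maximalIdeal (↥𝒪') Q
  rw [IsScalarTower.algebraMap_eq D (integralClosure D (FractionRing D)) 𝒪', ← Ideal.comap_comap]
  exact (congrArg (Ideal.comap (algebraMap D _)) h1).trans hQ

/-! ### The lifting lemma for an abstract commutative algebra of endomorphisms -/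

section Lift

attribute [local instance] FractionRing.liftAlgebra

variable {𝒪 : Type u} [CommRing 𝒪] [IsDomain 𝒪] [IsDiscreteValuationRing 𝒪]
  {M : Type u} [AddCommGroup M] [Module 𝒪 M] [Module.Free 𝒪 M] [Module.Finite 𝒪 M]
  {H : Type u} [CommRing H] [Algebra 𝒪 H] [Module.Finite 𝒪 H]
  {ι : H →ₐ[𝒪] Module.End 𝒪 M}

/-- **Lifting step over a quotient domain.** Let `H` be a commutative `𝒪`-algebra, finite over
the discrete valuation ring `𝒪`, acting faithfully on the finite free `𝒪`-module `M`; let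
`q : H → D` be an `𝒪`-algebra map to a domain `D` finite over `𝒪` into which `𝒪` injects, and
`n` a maximal ideal of `D`. Then there are a discrete valuation ring `𝒪' ⊇ 𝒪` with fraction field
`K' = Frac D` finite over `K = Frac 𝒪` and `𝔪' ∩ 𝒪 = n ∩ 𝒪`, and a non-zero common eigenvector
`f' ∈ 𝒪' ⊗ M` of `H` with character `χ' : H → D → 𝒪'`, and `χ'(h) ∈ 𝔪'` whenever `q h ∈ n`.
[cite: DeligneSerreASENS1974, Lemme 6.11 (proof)] -/
theorem exists_lift_of_quotient (hKA : KrullAkizuki.{u, u, u}) (hι : Function.Injective ι)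
    {D : Type u} [CommRing D] [IsDomain D] [Algebra 𝒪 D] [Module.Finite 𝒪 D] [FaithfulSMul 𝒪 D]
    (q : H →ₐ[𝒪] D) (n : Ideal D) [n.IsMaximal] :
    ∃ (K' : Type u) (_ : Field K') (_ : Algebra 𝒪 K') (_ : Algebra (FractionRing 𝒪) K')
      (_ : IsScalarTower 𝒪 (FractionRing 𝒪) K') (_ : FiniteDimensional (FractionRing 𝒪) K')
      (𝒪' : Type u) (_ : CommRing 𝒪') (_ : IsDomain 𝒪') (_ : IsDiscreteValuationRing 𝒪')
      (_ : Algebra 𝒪 𝒪') (_ : Algebra 𝒪' K') (_ : IsScalarTower 𝒪 𝒪' K')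
      (_ : IsFractionRing 𝒪' K'),
      (maximalIdeal 𝒪').comap (algebraMap 𝒪 𝒪') = n.comap (algebraMap 𝒪 D) ∧
      ∃ (χ' : H →ₐ[𝒪] 𝒪') (f' : 𝒪' ⊗[𝒪] M), f' ≠ 0 ∧
        (∀ h : H, (ι h).baseChange 𝒪' f' = χ' h • f') ∧
        ∀ h : H, q h ∈ n → χ' h ∈ maximalIdeal 𝒪' := by
  classical
  -- `D` is a one-dimensional Noetherian domain which is not a field
  haveI : IsNoetherianRing D := IsNoetherianRing.of_finite 𝒪 D
  haveI : Ring.DimensionLEOne D := Ring.DimensionLEOne.of_isIntegral 𝒪 D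
  have hDf : ¬ IsField D := fun hF ↦ IsDiscreteValuationRing.not_isField 𝒪
    ((Algebra.IsIntegral.isField_iff_isField (FaithfulSMul.algebraMap_injective 𝒪 D)).mpr hF)
  -- a discrete valuation ring `𝒪'` of `K' = Frac D` centred on `n` (Krull–Akizuki)
  obtain ⟨𝒪', _, _, _, _, _, _, _, _, hST, _, hcomap⟩ :=
    exists_dvr_of_isMaximal hKA (R := 𝒪) hDf n
  haveI : IsScalarTower 𝒪 𝒪' (FractionRing D) := hST
  -- `K'` is finite over `K`, hence flat over `𝒪`
  haveI : FiniteDimensional (FractionRing 𝒪) (FractionRing D) := inferInstance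
  haveI : Module.Flat 𝒪 (FractionRing D) :=
    Module.Flat.trans 𝒪 (FractionRing 𝒪) (FractionRing D)
  -- the lifted character `χ' : H → D → 𝒪'` occurs on an eigenvector of `K' ⊗ M` ...
  let χ' : H →ₐ[𝒪] 𝒪' := (IsScalarTower.toAlgHom 𝒪 D 𝒪').comp q
  let π : H →ₐ[𝒪] FractionRing D := (IsScalarTower.toAlgHom 𝒪 𝒪' (FractionRing D)).comp χ'
  obtain ⟨v, hv, hveig⟩ := exists_eigenvector_of_character (L := FractionRing D) hι π
  -- ... which descends to `𝒪' ⊗ M`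
  obtain ⟨f', hf', hf'eig⟩ := exists_eigenvector_descend (O' := 𝒪') (L := FractionRing D)
    (fun h : H ↦ ι h) (fun h ↦ χ' h) hv fun h ↦ hveig h
  refine ⟨FractionRing D, inferInstance, inferInstance, inferInstance, inferInstance,
    inferInstance, 𝒪', inferInstance, inferInstance, inferInstance, inferInstance, inferInstance, inferInstance, inferInstance, ?_, χ', f', hf', hf'eig, fun h hh ↦ ?_⟩
  · rw [IsScalarTower.algebraMap_eq 𝒪 D 𝒪', ← Ideal.comap_comap, hcomap]
  · rw [← hcomap, Ideal.mem_comap] at hh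
    exact hh

/-- **Lifting a character** (Deligne–Serre 1974, proof of Lemme 6.11, for an abstract algebra of
endomorphisms). Let `H` be a commutative `𝒪`-algebra, finite over the discrete valuation ring `𝒪`,
acting faithfully on the finite free `𝒪`-module `M`, and `χ : H → k` an `𝒪`-algebra map to the
residue field. Then there are a discrete valuation ring `𝒪' ⊇ 𝒪` with `𝔪' ∩ 𝒪 = 𝔪` and
fraction field finite over `Frac 𝒪`, and a non-zero common eigenvector `f' ∈ 𝒪' ⊗ M` of `H`
whose character `χ' : H → 𝒪'` lifts `χ`: `χ'(h) ≡ χ(h) (mod 𝔪')`.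
[cite: DeligneSerreASENS1974, Lemme 6.11 (proof)] -/
theorem exists_lift_of_character (hKA : KrullAkizuki.{u, u, u}) (hι : Function.Injective ι)
    (χ : H →ₐ[𝒪] ResidueField 𝒪) :
    ∃ (K' : Type u) (_ : Field K') (_ : Algebra 𝒪 K') (_ : Algebra (FractionRing 𝒪) K')
      (_ : IsScalarTower 𝒪 (FractionRing 𝒪) K') (_ : FiniteDimensional (FractionRing 𝒪) K')
      (𝒪' : Type u) (_ : CommRing 𝒪') (_ : IsDomain 𝒪') (_ : IsDiscreteValuationRing 𝒪')
      (_ : Algebra 𝒪 𝒪') (_ : Algebra 𝒪' K') (_ : IsScalarTower 𝒪 𝒪' K')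
      (_ : IsFractionRing 𝒪' K'),
      (maximalIdeal 𝒪').comap (algebraMap 𝒪 𝒪') = maximalIdeal 𝒪 ∧
      ∃ (χ' : H →ₐ[𝒪] 𝒪') (f' : 𝒪' ⊗[𝒪] M), f' ≠ 0 ∧
        (∀ h : H, (ι h).baseChange 𝒪' f' = χ' h • f') ∧
        ∀ (h : H) (s : 𝒪), residue 𝒪 s = χ h → χ' h - algebraMap 𝒪 𝒪' s ∈ maximalIdeal 𝒪' := by
  classical
  have hχO : ∀ s : 𝒪, χ (algebraMap 𝒪 H s) = residue 𝒪 s := fun s ↦ by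
    rw [AlgHom.commutes, ResidueField.algebraMap_eq]
  have hχsurj : Function.Surjective χ := fun c ↦ by
    obtain ⟨s, rfl⟩ := residue_surjective c
    exact ⟨algebraMap 𝒪 H s, hχO s⟩
  haveI hkmax : (RingHom.ker χ).IsMaximal := RingHom.ker_isMaximal_of_surjective χ hχsurj
  -- a minimal prime `p ⊆ ker χ`; it meets `𝒪` trivially (`H ↪ End M` is torsion-free)
  obtain ⟨p, hpmin, hple⟩ :=
    Ideal.exists_minimalPrimes_le (I := (⊥ : Ideal H)) (J := RingHom.ker χ) bot_le
  haveI hp : p.IsPrime := hpmin.1.1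
  have hpO : ∀ s : 𝒪, algebraMap 𝒪 H s ∈ p → s = 0 := by
    intro s hs
    by_contra hs0
    refine notMem_nonZeroDivisors_of_mem_mem_minimalPrimes hs hpmin ?_
    refine mem_nonZeroDivisors_iff_right.mpr fun h hh ↦ hι ?_
    refine LinearMap.ext fun m ↦ ?_
    have := congrArg (fun g : H ↦ ι g m) hh
    simp only [map_mul, AlgHom.commutes, Module.End.mul_apply, Module.algebraMap_end_apply,
      map_zero, LinearMap.zero_apply, map_smul, smul_eq_zero_iff_right hs0] at this
    simpa using this
  -- `D = H / p`, a domain finite over `𝒪` into which `𝒪` injects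
  haveI : IsDomain (H ⧸ p) := Ideal.Quotient.isDomain p
  haveI : Module.Finite 𝒪 (H ⧸ p) :=
    Module.Finite.of_surjective (Ideal.Quotient.mkₐ 𝒪 p).toLinearMap Ideal.Quotient.mk_surjective
  have hinj : Function.Injective (algebraMap 𝒪 (H ⧸ p)) := by
    intro s t hst
    rw [← sub_eq_zero]
    apply hpO
    rw [IsScalarTower.algebraMap_apply 𝒪 H (H ⧸ p), IsScalarTower.algebraMap_apply 𝒪 H (H ⧸ p),
      Ideal.Quotient.algebraMap_eq, Ideal.Quotient.eq] at hst
    rwa [map_sub]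
  haveI : FaithfulSMul 𝒪 (H ⧸ p) := (faithfulSMul_iff_algebraMap_injective 𝒪 (H ⧸ p)).mpr hinj
  -- the character `χ̄ : D → k` and its kernel `n`, a maximal ideal above `𝔪`
  let χbar : (H ⧸ p) →ₐ[𝒪] ResidueField 𝒪 := Ideal.Quotient.liftₐ p χ fun x hx ↦ hple hx
  have hχbar : ∀ x : H, χbar (Ideal.Quotient.mk p x) = χ x := fun x ↦ rfl
  have hχbarsurj : Function.Surjective χbar := fun c ↦ by
    obtain ⟨x, rfl⟩ := hχsurj c
    exact ⟨Ideal.Quotient.mk p x, hχbar x⟩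
  haveI : (RingHom.ker χbar).IsMaximal := RingHom.ker_isMaximal_of_surjective χbar hχbarsurj
  have hnO : (RingHom.ker χbar).comap (algebraMap 𝒪 (H ⧸ p)) = maximalIdeal 𝒪 := by
    ext s
    rw [Ideal.mem_comap, RingHom.mem_ker, IsScalarTower.algebraMap_apply 𝒪 H (H ⧸ p),
      Ideal.Quotient.algebraMap_eq, hχbar, hχO, residue_eq_zero_iff]
  -- lift over `D`
  obtain ⟨K', _, _, _, _, _, 𝒪', _, _, _, _, _, _, _, hcomap, χ', f', hf', heig, hcong⟩ :=
    exists_lift_of_quotient hKA hι (Ideal.Quotient.mkₐ 𝒪 p) (RingHom.ker χbar)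
  refine ⟨K', inferInstance, inferInstance, inferInstance, inferInstance, inferInstance, 𝒪', inferInstance, inferInstance, inferInstance, inferInstance, inferInstance, inferInstance, inferInstance, hcomap.trans hnO,
    χ', f', hf', heig, fun h s hs ↦ ?_⟩
  have hmem : Ideal.Quotient.mkₐ 𝒪 p (h - algebraMap 𝒪 H s) ∈ RingHom.ker χbar := by
    rw [RingHom.mem_ker, Ideal.Quotient.mkₐ_eq_mk, hχbar, map_sub, hχO, hs, sub_self]
  simpa only [map_sub, AlgHom.commutes] using hcong _ hmem

end Lift

/-! ### Deligne–Serre 1974, Lemme 6.11 -/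

open scoped IsMulCommutative in
/-- **Deligne–Serre 1974, Lemme 6.11 (the Deligne–Serre lifting lemma), from Krull–Akizuki.**
Apply `exists_lift_of_character` to the commutative subalgebra `H = 𝒪[𝒯] ⊆ End_𝒪(M)` (finite
over `𝒪` as a submodule of the finite free module `End_𝒪(M)`, `𝒪` being Noetherian) and to the
character `χ : H → k` of the common eigenvector `f ∈ k ⊗ M` (`exists_eigenCharacter`).
[cite: DeligneSerreASENS1974, Lemme 6.11] -/
theorem lemma611_of_krullAkizuki (hKA : KrullAkizuki.{u, u, u}) : lemma611.{u} := by
  intro 𝒪 _ _ _ M _ _ _ _ 𝒯 hcomm a f hf heig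
  classical
  haveI : IsMulCommutative (Algebra.adjoin 𝒪 𝒯) :=
    Algebra.isMulCommutative_adjoin 𝒪 fun S hS T hT ↦ (hcomm S hS T hT).eq
  haveI : Module.Finite 𝒪 (Algebra.adjoin 𝒪 𝒯) :=
    Module.Finite.of_injective (Algebra.adjoin 𝒪 𝒯).val.toLinearMap Subtype.val_injective
  obtain ⟨χ, -, hχa⟩ := exists_eigenCharacter 𝒯 a hf heig
  obtain ⟨K', _, _, _, _, _, 𝒪', _, _, _, _, _, _, _, hcomap, χ', f', hf', heig', hcong⟩ :=
    exists_lift_of_character hKA (ι := (Algebra.adjoin 𝒪 𝒯).val) Subtype.val_injective χ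
  refine ⟨K', inferInstance, inferInstance, inferInstance, inferInstance, inferInstance, 𝒪', inferInstance, inferInstance, inferInstance, inferInstance, inferInstance, inferInstance, inferInstance, hcomap,
    fun T ↦ if hT : T ∈ Algebra.adjoin 𝒪 𝒯 then χ' ⟨T, hT⟩ else 0, f', hf',
    fun T hT ↦ ?_, fun T hT s hs ↦ ?_⟩
  · have hT' : T ∈ Algebra.adjoin 𝒪 𝒯 := Algebra.subset_adjoin hT
    dsimp only
    rw [dif_pos hT']
    exact heig' ⟨T, hT'⟩
  · have hT' : T ∈ Algebra.adjoin 𝒪 𝒯 := Algebra.subset_adjoin hT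
    dsimp only
    rw [dif_pos hT']
    exact hcong ⟨T, hT'⟩ s (hs.trans (hχa T hT).symm)

/-- **Deligne–Serre 1974, Lemme 6.11 (the Deligne–Serre lifting lemma)**, unconditionally:
`lemma611_of_krullAkizuki` fed with the Krull–Akizuki theorem `KrullAkizuki_holds` of Part I.
This discharges the named fact `Literature.RingTheory.DiscreteValuationRing.DeligneSerre1974.lemma611`.
[cite: DeligneSerreASENS1974, Lemme 6.11] -/
theorem lemma611_holds : lemma611.{u} :=
  lemma611_of_krullAkizuki KrullAkizuki_holds

end Literature.RingTheory.DiscreteValuationRing.DeligneSerre1974
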